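import Literature.MathematicalPhysics.QuantumFieldTheory.BalabanImbrieJaffe1984to88.BIJ88ScalarTranslation330Torus
import Literature.MathematicalPhysics.QuantumFieldTheory.Balaban1983to89.B10StarCount
import Literature.MathematicalPhysics.QuantumFieldTheory.BalabanImbrieJaffe1984to88.BIJ88Small333ScalarField

/-!
# `BalabanImbrieJaffe1984to88.BIJ88ScalarTranslation330Size` — T. Bałaban, J. Imbrie, A. Jaffe, *Effective action and cluster properties of the
abelian Higgs model*, Commun. Math. Phys. **114** (1988) 257–315 [BalabanImbrieJaffe1988], Sect. 3 p. 270 [PDF 14] with Sect. 2 p. 264 [PDF 8]: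
**THE SIZE OF THE (3.30) CORRECTION `C^{(0)}_{loc}(u₁)Q*(u₁)ψ`** — the companion `BIJ88ScalarTranslation330Torus` composed the correction `corr330`
from the objects of record and proved the (2.43)/(2.47) clauses for its kernel UNDER [6] (5.6) of the charted operator; here (5.6) is DISCHARGED for the
first-step operator `−Δ_{u₁} + aL^{−2}Q(u₁)*Q(u₁)` at a small field on a region that does not wrap around the torus (p. 264 *"by (2.38), C^{(k)}_Λ(u)^{−1}
is bounded below"* — for `−Δ_{u₁}` the (2.38)-shape bound is an IDENTITY — and the kernel of `−Δ_{u₁}` has range one), and the bound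
`‖(C^{(0)}_{Λ,loc}(u₁)Q*(u₁)ψ)(x)‖ ≤ C·sup‖ψ‖` with the crude consequence `‖φ^{(0)}(x)‖ ≤ ‖φ(x)‖ + aL^{−2}C·sup‖ψ‖` for the translated field of (3.30)
are proved; and p27 g40's λ-free (3.33) scalar half (`BIJ88Small333ScalarField`) is instantiated at the composed objects.

statement-level skeleton of published theorems with citation tags; proofs where landed; nothing here is a claim about the Yang–Mills mass gap

PDF held: `paper:balaban1988-cmp114-bij-abelian-higgs-effective-action` (journal page = PDF page + 256); pp. 264–265, 270 [PDF 8–9, 14] re-read this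
session from the text layer.

CITATION HEADER (lean-in-tree rule).  Part of the lit-balaban TYPED SKELETON (HOME `run/shared/lean/pub/lit-balaban/`), PHASE-2 proof seat p29 gen 34
(unit `lit-balaban-p29`; TAKING line HOME/STATUS.md 2026-08-23T12:41Z, free-target protocol G.5-34(d)).  Rows served (cells): **C2.Eq3.30** (the size
of the composed correction), **C2.Eq2.43** (*"bounded as in (2.41)"* for the first-step operator, hypothesis-free up to the walk-data conditions),
**C2.Eq3.33** (the crude `φ^{(0)}` bound, and p27's λ-free scalar half AT the composed objects).  Owner r18.

THE PRINTED TEXT (verbatim).  p. 270 [PDF 14]: *"Again we make a local translation, φ = φ^{(0)} + aL^{−2}Λ₇^{(0)}C^{(0)}_{loc}(u₁)Q*(u₁)ψ. (3.30) … Similarly,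
it can be shown that |A^{(0)}| ≦ cp(e₀) in Λ₁^{(0)*}, |φ^{(0)}| ≦ cp(e₀) in Λ₁^{(0)*}, (3.33)"*.  p. 264 [PDF 8]: *"This is of course a nonlocal operator,
but by (2.38), C^{(k)}_Λ(u)^{−1} is bounded below and a random walk expansion as in [6] can be used to prove that |C^{(k)}_Λ(u; x₁, x₂)| ≦ ce^{−c|x₁−x₂|}.
(2.41) … The local part C^{(k)}_{Λ,loc}(u; x₁, x₂) … vanishes for |x₁ − x₂| > ½r(e_k) and is bounded as in (2.41)."*  [6] = [Balaban1983RegularityDecay]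
(5.6) p. 594: *"A ≥ γ₀I, |A(x,x′)| ≤ c₀e^{−δ₀|x−x′|}"*.

WHAT IS PROVED (kernel-checked, 0 `sorry`; theorems only, no definition, no `Prop`-valued fact).
* §1 THE KERNEL OF `−Δ_u`: `norm_dN_univ_apply_le` (an entry of `D_u` is `c·u(b)` at `b₊`, `−c` at `b₋`, `0` elsewhere — p31's `dN_univ_apply`), the bond
  counts `sum_ite_src_one` / `sum_ite_tgt_one` (`d` bonds start, `d` bonds end at every site of the torus — the product equivalence behind the tree's `Fintype (PBond P j)` and
  `B10StarCount.shift_unshift` / `unshift_shift`), `lapU_apply`, **`norm_lapU_apply_le`** (`‖(−Δ_u)(x₁,x₂)‖ ≤ 4dc²`), `lapU_apply_ne_zero` (a nonzero entry joins equal or bonded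
  sites), **`norm_lapU_apply_le_cdist`** (on a region whose bonds are chart-neighbours: `‖(−Δ_u)(x₁,x₂)‖ ≤ 4dc²e^{δ₀}·e^{−δ₀|x₁−x₂|_chart}`).
* §2 [6] (5.6) AND INVERTIBILITY FOR THE FIRST-STEP OPERATOR: **`hyp56_nOp_univ_smallField`** — for `|u(b) − 1| ≤ T` on the bonds inside the
  `L`-blocks, holonomy deviation `≤ δ`, `2(L−1)L·d·T² + 2δ² ≤ σ`, a no-wrap `Λ`: `B4.Hyp56 Λ′ (reOp Λ (−Δ_u + κQ*Q)) (c240(c²,κ)(1−σ)) (4dc²e^{δ₀} +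
  κL^{−2d}e^{δ₀(L−1)}) δ₀` (p31's `hyp56_op240_smallField` at `Δ := lapU`, the companion's `nOp_univ_eq_op240` / `h238_lapU`);
  **`isUnit_compress_nOp_univ_smallField`** (p31's `isUnit_compress_op240_smallField`; `σ < 1`, `κ > 0`, `c ≠ 0`).
* §3 SIZES: `card_filter_cdist_le` (at most `(2R+1)^d` sites within chart distance `R`), **`norm_corr330_le`** (under (5.6) of the charted operator:
  `‖(C^{(0)}_{Λ,loc}Q*ψ)(x)‖ ≤ (2R+1)^d·2K·L^{−d}·S`, `K = 2^dγ₀^{−1}(1−θ_W)^{−1}e^{δ₀/4}`, `2ρM ≤ R`, `S` a bound for `ψ` on the blocks of `Λ`),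
  **`norm_phi0_le`** (the CRUDE bound for the new variable of (3.30): `‖φ^{(0)}(x)‖ ≤ ‖φ(x)‖ + aL^{−2}·(2R+1)^d·2K·L^{−d}·S`), and the assembled
  small-field member **`norm_corr330_le_smallField`** (§2 + §3: the constants of (5.6) made explicit for `−Δ_{u₁} + aL^{−2}Q(u₁)*Q(u₁)`).
* §4 (3.33), SCALAR HALF, AT THE COMPOSED OBJECTS: **`small333_scalar_corr330`** — p27 g40's λ-free theorem `BIJ88Small333ScalarField.
  small333_scalar_phi330_full` (fluctuation mechanism + (2.41)/(2.47) + located margin; stated over an abstract kernel `K` characterised as the (2.43)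
  packaging) INSTANTIATED BY NAME at `K := cLocC Λ (nOp (aL⁻²) c u₁ 1 univ) M ρ`, `corr := corr330 …` (`rfl`), `φ = phi330 Λ₇ a L φ^{(0)} corr330`;
  **`small333_scalar_corr330_smallField`** — the same with (5.6)/invertibility DISCHARGED by §2 (explicit `γ₀`, `c₀`).
HONEST SCOPE.  (i) §3's crude bound alone gives only `c′λ₀^{−1/4}p(e₀)` from (3.15)/(3.32); the printed λ-free *"|φ^{(0)}| ≦ cp(e₀)"* is p27 g40's
`BIJ88Small333ScalarField` (fluctuation mechanism `φ^{(0)} = C D*(D_uφ) − aL^{−2}CQ*(ψ − Qφ) +` boundary + localization terms), here only INSTANTIATED at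
the composed objects (§4) — its hypotheses (bounds `pD, pQ, Φ, Ψ`, located margin `R`, smallness side conditions) are carried verbatim, not discharged.  (ii) The walk data `M ≥ 5`, `M > K_R`, `M > Θ₁`, `θ_W < 1` (p13's constants at the explicit `γ₀, c₀, δ₀` of §2; print:
`M = O(1)`) and `ρ` (print `ρM = ¼r(e₀)`) are hypotheses / parameters, as in p31's files.  (iii) NO-WRAP REGION: `Λ`'s bonds are chart-neighbours
(`cdist b₋ b₊ ≤ 1`) — true for `Λ` inside a box not crossing the coordinate seam (p31's half-torus boxes); on such `Λ` the chart distance of the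
conclusions is the torus distance (p31's `cdist_eq_T_of_two_mul_abs_le`, not repeated).  (iv) Small field in p31's `(T, δ, σ)` form; `U(1)`; any
`d ≥ 1`; `j + 1 ≤ m + K`.  Imports the companion, the tree's `B10StarCount` (torus shifts) and p27's `BIJ88Small333ScalarField`; Literature only; NOT summit progress; NOT continuum; NOT Clay.
-/

open scoped BigOperators Matrix ComplexConjugate
open Finset Matrix

namespace Literature.MathematicalPhysics.QuantumFieldTheory.BalabanImbrieJaffe1984to88.BIJ88ScalarTranslation330Size

open Literature.MathematicalPhysics.QuantumFieldTheory.Balaban1983to89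
open BIJ88Sect3Statements (U1 toC cfg covD starB mem_starB norm_toC)
open BIJ88Sect3Translations (phi330)
open BIJ85BlockAveragesTorus BIJ85BlockAveragesTorusK
open BIJ88NeumannPropagator227Torus (nOp dN qMatK dN_apply)
open BIJ88NeumannPropagatorFlatDecay (dN_univ_apply)
open BIJ88DeltaLoc234Torus (qMatT)
open BIJ88Eq240FlatTorus (compress op240 c240 c240_pos)
open BIJ88Decay241SmallFieldTorus (isUnit_compress_op240_smallField)
open BIJ88RandomWalk242 BIJ88Eq242Lattice BIJ88Ineq246Lattice B4Sect5CubeBounds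
open BIJ88Eq242HiggsCovarianceTorus
open BIJ88ScalarTranslation330Torus

noncomputable section

variable {P : Params} {j : ℕ}

/-! ## §1  The kernel of `−Δ_u`: range one, entries at most `4dc²` -/

section Kernel

/-- kernel: `‖D_u(b, x)‖ ≤ |c|·(𝟙[x = b₊] + 𝟙[x = b₋])` (`|u(b)| = 1`; the entries of the uncut `dN` are p31's
`BIJ88NeumannPropagatorFlatDecay.dN_univ_apply`). [cite: BalabanImbrieJaffe1988, (3.3) p.265] -/
theorem norm_dN_univ_apply_le (c : ℝ) (U : GaugeField P j U1) (b : PBond P j) (x : Balaban1983to89.Site P j) :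
    ‖dN c U univ b x‖ ≤ |c| * ((if x = b.tgt then (1 : ℝ) else 0) + (if x = b.src then (1 : ℝ) else 0)) := by
  rw [dN_univ_apply, mul_add]
  refine (norm_sub_le _ _).trans (add_le_add ?_ ?_)
  · rw [norm_mul, Complex.norm_real, Real.norm_eq_abs]
    refine mul_le_mul_of_nonneg_left ?_ (abs_nonneg c)
    split_ifs
    · rw [show cfg U b = toC (U b) from rfl, norm_toC]
    · rw [norm_zero]
  · rw [norm_mul, Complex.norm_real, Real.norm_eq_abs]
    refine mul_le_mul_of_nonneg_left ?_ (abs_nonneg c)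
    split_ifs
    · rw [norm_one]
    · rw [norm_zero]

/-- kernel: `D_u(b, x) ≠ 0` only at the two ends of `b`. [cite: BalabanImbrieJaffe1988, (3.3) p.265] -/
theorem dN_univ_apply_eq_zero (c : ℝ) (U : GaugeField P j U1) {b : PBond P j} {x : Balaban1983to89.Site P j} (h₁ : x ≠ b.tgt) (h₂ : x ≠ b.src) :
    dN c U univ b x = 0 := by
  rw [dN_univ_apply, if_neg h₁, if_neg h₂, mul_zero, sub_zero]

/-- **exactly `d` bonds START at each site of the torus**: `Σ_b 𝟙[x = b₋] = d`. [cite: Balaban1985Averaging, (5) p.18] -/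
theorem sum_ite_src_one (x : Balaban1983to89.Site P j) : (∑ b : PBond P j, if x = b.src then (1 : ℝ) else 0) = P.d := by
  rw [← Fintype.sum_equiv (⟨fun p => ⟨p.1, p.2⟩, fun b => (b.src, b.dir), fun _ => rfl, fun _ => rfl⟩ :
      Balaban1983to89.Site P j × Fin P.d ≃ PBond P j) (fun p => if x = p.1 then (1 : ℝ) else 0) _ (fun p => rfl), Fintype.sum_prod_type]
  have hy : ∀ y : Balaban1983to89.Site P j, (∑ _μ : Fin P.d, if x = y then (1 : ℝ) else 0) = if x = y then (P.d : ℝ) else 0 := fun y => by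
    rw [Finset.sum_const, Finset.card_univ, Fintype.card_fin]
    split_ifs <;> simp
  simp_rw [hy]
  rw [Finset.sum_ite_eq univ x, if_pos (mem_univ x)]

/-- **exactly `d` bonds END at each site of the torus**: `Σ_b 𝟙[x = b₊] = d` (the shift by `e_μ` is a bijection — the tree's
`B10StarCount.shift_unshift` / `unshift_shift`). [cite: Balaban1985Averaging, (5) p.18] -/
theorem sum_ite_tgt_one (x : Balaban1983to89.Site P j) : (∑ b : PBond P j, if x = b.tgt then (1 : ℝ) else 0) = P.d := by
  rw [← Fintype.sum_equiv (⟨fun p => ⟨p.1, p.2⟩, fun b => (b.src, b.dir), fun _ => rfl, fun _ => rfl⟩ :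
      Balaban1983to89.Site P j × Fin P.d ≃ PBond P j) (fun p => if x = p.1.shift p.2 then (1 : ℝ) else 0) _ (fun p => rfl),
    Fintype.sum_prod_type, Finset.sum_comm]
  have hμ : ∀ μ : Fin P.d, (∑ y : Balaban1983to89.Site P j, if x = y.shift μ then (1 : ℝ) else 0) = 1 := by
    intro μ
    have heq : ∀ y : Balaban1983to89.Site P j, (x = y.shift μ) = (x.unshift μ = y) := by
      intro y
      apply propext
      constructor
      · intro h; rw [h, B10StarCount.unshift_shift]
      · intro h; rw [← h, B10StarCount.shift_unshift]
    simp_rw [heq]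
    rw [Finset.sum_ite_eq univ (x.unshift μ), if_pos (mem_univ _)]
  simp_rw [hμ]
  simp

/-- kernel: the entries of `−Δ_u = D_uᴴD_u`: `(−Δ_u)(x₁,x₂) = Σ_b conj(D_u(b,x₁))·D_u(b,x₂)`. [cite: BalabanImbrieJaffe1988, (3.31) p.270] -/
theorem lapU_apply (c : ℝ) (U : GaugeField P j U1) (x₁ x₂ : Balaban1983to89.Site P j) :
    lapU c U x₁ x₂ = ∑ b : PBond P j, (starRingEnd ℂ) (dN c U univ b x₁) * dN c U univ b x₂ := by
  rw [lapU, Matrix.mul_apply]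
  exact Finset.sum_congr rfl fun b _ => by rw [conjTranspose_apply, Complex.star_def]

/-- **`‖(−Δ_u)(x₁,x₂)‖ ≤ 4dc²`** uniformly in the torus and in the field (each of the `2d` bonds at `x₁` contributes at most `2c²`).
[cite: BalabanImbrieJaffe1988, (3.31) p.270] -/
theorem norm_lapU_apply_le (c : ℝ) (U : GaugeField P j U1) (x₁ x₂ : Balaban1983to89.Site P j) : ‖lapU c U x₁ x₂‖ ≤ 4 * P.d * c ^ 2 := by
  rw [lapU_apply]
  have hterm : ∀ b : PBond P j, ‖(starRingEnd ℂ) (dN c U univ b x₁) * dN c U univ b x₂‖ ≤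
      2 * c ^ 2 * ((if x₁ = b.tgt then (1 : ℝ) else 0) + (if x₁ = b.src then (1 : ℝ) else 0)) := by
    intro b
    rw [norm_mul, Complex.norm_conj]
    have h1 := norm_dN_univ_apply_le c U b x₁
    have h2 : ‖dN c U univ b x₂‖ ≤ |c| * 2 := by
      refine (norm_dN_univ_apply_le c U b x₂).trans (mul_le_mul_of_nonneg_left ?_ (abs_nonneg c))
      split_ifs <;> norm_num
    have hi : 0 ≤ (if x₁ = b.tgt then (1 : ℝ) else 0) + (if x₁ = b.src then (1 : ℝ) else 0) := by positivity
    calc ‖dN c U univ b x₁‖ * ‖dN c U univ b x₂‖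
        ≤ (|c| * ((if x₁ = b.tgt then (1 : ℝ) else 0) + (if x₁ = b.src then (1 : ℝ) else 0))) * (|c| * 2) :=
          mul_le_mul h1 h2 (norm_nonneg _) (mul_nonneg (abs_nonneg c) hi)
      _ = 2 * c ^ 2 * ((if x₁ = b.tgt then (1 : ℝ) else 0) + (if x₁ = b.src then (1 : ℝ) else 0)) := by
          rw [← sq_abs c]; ring
  calc ‖∑ b : PBond P j, (starRingEnd ℂ) (dN c U univ b x₁) * dN c U univ b x₂‖
      ≤ ∑ b : PBond P j, ‖(starRingEnd ℂ) (dN c U univ b x₁) * dN c U univ b x₂‖ := norm_sum_le _ _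
    _ ≤ ∑ b : PBond P j, 2 * c ^ 2 * ((if x₁ = b.tgt then (1 : ℝ) else 0) + (if x₁ = b.src then (1 : ℝ) else 0)) :=
        Finset.sum_le_sum fun b _ => hterm b
    _ = 4 * P.d * c ^ 2 := by
        rw [← Finset.mul_sum, Finset.sum_add_distrib, sum_ite_tgt_one, sum_ite_src_one]; ring

/-- kernel: a nonzero entry `(−Δ_u)(x₁,x₂) ≠ 0` joins two sites that are equal or the two ends of one bond (range one).
[cite: BalabanImbrieJaffe1988, (3.31) p.270] -/
theorem lapU_apply_ne_zero (c : ℝ) (U : GaugeField P j U1) {x₁ x₂ : Balaban1983to89.Site P j} (h : lapU c U x₁ x₂ ≠ 0) :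
    x₁ = x₂ ∨ ∃ b : PBond P j, (x₁ = b.src ∧ x₂ = b.tgt) ∨ (x₁ = b.tgt ∧ x₂ = b.src) := by
  rw [lapU_apply] at h
  obtain ⟨b, _, hb⟩ := Finset.exists_ne_zero_of_sum_ne_zero h
  have h₁ : dN c U univ b x₁ ≠ 0 := fun h0 => hb (by rw [h0, map_zero, zero_mul])
  have h₂ : dN c U univ b x₂ ≠ 0 := fun h0 => hb (by rw [h0, mul_zero])
  have e₁ : x₁ = b.tgt ∨ x₁ = b.src := by
    by_contra hc; exact h₁ (dN_univ_apply_eq_zero c U (fun e => hc (Or.inl e)) fun e => hc (Or.inr e))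
  have e₂ : x₂ = b.tgt ∨ x₂ = b.src := by
    by_contra hc; exact h₂ (dN_univ_apply_eq_zero c U (fun e => hc (Or.inl e)) fun e => hc (Or.inr e))
  rcases e₁ with e₁ | e₁ <;> rcases e₂ with e₂ | e₂
  · exact Or.inl (e₁.trans e₂.symm)
  · exact Or.inr ⟨b, Or.inr ⟨e₁, e₂⟩⟩
  · exact Or.inr ⟨b, Or.inl ⟨e₁, e₂⟩⟩
  · exact Or.inl (e₁.trans e₂.symm)

/-- kernel: the chart distance of a site to itself vanishes. [cite: BalabanImbrieJaffe1988, (2.41) p.264] -/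
theorem cdist_self (x : Balaban1983to89.Site P j) : cdist x x = 0 := dist_self _

/-- **THE (2.36)/[6] (5.6)-SHAPE KERNEL BOUND FOR `−Δ_u` ON A NO-WRAP REGION**: if the bonds of `Λ` are chart-neighbours (`|b₋ − b₊|_chart ≤ 1` whenever
both ends lie in `Λ` — `Λ` does not cross the coordinate seam of the torus chart) then on `Λ × Λ`
`‖(−Δ_u)(x₁,x₂)‖ ≤ 4dc²e^{δ₀}·e^{−δ₀|x₁−x₂|_chart}` for every `δ₀ ≥ 0`. [cite: BalabanImbrieJaffe1988, (2.36) p.263] -/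
theorem norm_lapU_apply_le_cdist (c : ℝ) (U : GaugeField P j U1) {Λ : Finset (Balaban1983to89.Site P j)}
    (hΛ : ∀ b : PBond P j, b.src ∈ Λ → b.tgt ∈ Λ → cdist b.src b.tgt ≤ 1) {δ₀ : ℝ} (hδ₀ : 0 ≤ δ₀)
    {x₁ : Balaban1983to89.Site P j} (h₁ : x₁ ∈ Λ) {x₂ : Balaban1983to89.Site P j} (h₂ : x₂ ∈ Λ) :
    ‖lapU c U x₁ x₂‖ ≤ 4 * P.d * c ^ 2 * Real.exp δ₀ * Real.exp (-(δ₀ * cdist x₁ x₂)) := by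
  by_cases h0 : lapU c U x₁ x₂ = 0
  · rw [h0, norm_zero]; positivity
  · have hd : cdist x₁ x₂ ≤ 1 := by
      rcases lapU_apply_ne_zero c U h0 with h | ⟨b, ⟨hs, ht⟩ | ⟨ht, hs⟩⟩
      · rw [h, cdist_self]; exact zero_le_one
      · rw [hs, ht]; exact hΛ b (hs ▸ h₁) (ht ▸ h₂)
      · rw [hs, ht, cdist_comm]; exact hΛ b (hs ▸ h₂) (ht ▸ h₁)
    have hexp : 1 ≤ Real.exp δ₀ * Real.exp (-(δ₀ * cdist x₁ x₂)) := by
      rw [← Real.exp_add]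
      exact Real.one_le_exp (by nlinarith)
    calc ‖lapU c U x₁ x₂‖ ≤ 4 * P.d * c ^ 2 * 1 := by rw [mul_one]; exact norm_lapU_apply_le c U x₁ x₂
      _ ≤ 4 * P.d * c ^ 2 * (Real.exp δ₀ * Real.exp (-(δ₀ * cdist x₁ x₂))) :=
          mul_le_mul_of_nonneg_left hexp (by positivity)
      _ = _ := by ring

end Kernel

/-! ## §2  [6] (5.6) and invertibility for the first-step operator `(−Δ_{u₁} + κQ(u₁)*Q(u₁))|_Λ` at a small field -/

section Hyp

/-- **[6] (5.6) FOR THE CHARTED FIRST-STEP OPERATOR `(−Δ_u + κQ(u)*Q(u))|_Λ` AT A SMALL FIELD** — p. 264 *"by (2.38), C^{(k)}_Λ(u)^{−1} is bounded below"*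
at the first step: for a bond field with `|u(b) − 1| ≤ T` on the bonds inside the `L`-blocks and holonomy deviation `≤ δ`, `2(L−1)L·d·T² + 2δ² ≤ σ`, on a
no-wrap region `Λ`, the charted real operator `reOp Λ (nOp κ c u 1 univ)` satisfies `B4.Hyp56` with `γ₀ = c240(c², κ)(1 − σ)` (the (2.38)-shape bound
of `−Δ_u` is exact, `E = 0`), `c₀ = 4dc²e^{δ₀} + κL^{−2d}e^{δ₀(L−1)}`, rate `δ₀` — p31's `hyp56_op240_smallField` at `Δ := −Δ_u`.
[cite: BalabanImbrieJaffe1988, (2.40) p.264] [cite: Balaban1983RegularityDecay, (5.6) p.594] -/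
theorem hyp56_nOp_univ_smallField (hj : j + 1 ≤ P.m + P.K) (U : GaugeField P j U1) {T δ σ : ℝ}
    (hInt : ∀ b : PBond P j, blkIter 1 b.src = blkIter 1 b.tgt → ‖toC (U b) - 1‖ ≤ T)
    (hTree : ∀ x : Balaban1983to89.Site P j, ‖holCK U 1 x - 1‖ ≤ δ)
    (hσ : 2 * (((P.L : ℝ) - 1) * P.L) * P.d * T ^ 2 + 2 * δ ^ 2 ≤ σ)
    {Λ : Finset (Balaban1983to89.Site P j)} (hΛ : ∀ b : PBond P j, b.src ∈ Λ → b.tgt ∈ Λ → cdist b.src b.tgt ≤ 1)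
    (c : ℝ) {κ : ℝ} (hκ : 0 ≤ κ) {δ₀ : ℝ} (hδ₀ : 0 ≤ δ₀) :
    B4.Hyp56 (chartSet Λ) (reOp Λ (nOp κ c U 1 univ)) (c240 P (c ^ 2) κ * (1 - σ) - 0)
      (4 * P.d * c ^ 2 * Real.exp δ₀ + κ * (((P.L : ℝ) ^ P.d)⁻¹) ^ 2 * Real.exp (δ₀ * ((P.L : ℝ) - 1))) δ₀ := by
  rw [nOp_univ_eq_op240]
  exact hyp56_op240_smallField hj U hInt hTree hσ (lapU_isHermitian c U) (sq_nonneg c) hκ (h238_lapU c U Λ) hδ₀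
    fun x₁ h₁ x₂ h₂ => norm_lapU_apply_le_cdist c U hΛ hδ₀ h₁ h₂

/-- **`(−Δ_u + κQ(u)*Q(u))|_Λ` IS INVERTIBLE at a small field** (`σ < 1`, `κ > 0`, `c ≠ 0`; any `Λ`) — the existence of the first-step propagator
`C^{(0)}_Λ(u₁)` of (2.40): p31's `isUnit_compress_op240_smallField` at `Δ := −Δ_u` (the (2.38)-shape bound exact).
[cite: BalabanImbrieJaffe1988, (2.40) p.264] -/
theorem isUnit_compress_nOp_univ_smallField (hj : j + 1 ≤ P.m + P.K) (U : GaugeField P j U1) {T δ σ : ℝ}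
    (hInt : ∀ b : PBond P j, blkIter 1 b.src = blkIter 1 b.tgt → ‖toC (U b) - 1‖ ≤ T)
    (hTree : ∀ x : Balaban1983to89.Site P j, ‖holCK U 1 x - 1‖ ≤ δ)
    (hσ : 2 * (((P.L : ℝ) - 1) * P.L) * P.d * T ^ 2 + 2 * δ ^ 2 ≤ σ) (hσ1 : σ < 1)
    (Λ : Finset (Balaban1983to89.Site P j)) {c : ℝ} (hc : c ≠ 0) {κ : ℝ} (hκ : 0 < κ) :
    IsUnit (compress Λ (nOp κ c U 1 univ)) := by
  rw [nOp_univ_eq_op240]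
  have hE : (0 : ℝ) < c240 P (c ^ 2) κ * (1 - σ) := mul_pos (c240_pos P (by positivity) hκ) (by linarith)
  exact isUnit_compress_op240_smallField hj U hInt hTree hσ (sq_nonneg c) hκ.le hE (h238_lapU c U Λ)

end Hyp

/-! ## §3  The size of the correction and the crude bound for `φ^{(0)}` -/

section Size

/-- **at most `(2R+1)^d` sites lie within chart distance `R` of a site** (the chart is injective into `ℤ^d` and the condition confines every
coordinate to an interval of `2R+1` integers). [cite: BalabanImbrieJaffe1988, (2.43) p.264] -/
theorem card_filter_cdist_le (x : Balaban1983to89.Site P j) (R : ℕ) :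
    (univ.filter fun x' : Balaban1983to89.Site P j => cdist x x' ≤ R).card ≤ (2 * R + 1) ^ P.d := by
  classical
  set S := univ.filter fun x' : Balaban1983to89.Site P j => cdist x x' ≤ R with hS
  set B : Finset (Fin P.d → ℤ) := Fintype.piFinset fun μ => Finset.Icc (chart x μ - R) (chart x μ + R) with hB
  have hmap : S.map chartEmb ⊆ B := by
    intro z hz
    rw [Finset.mem_map] at hz
    obtain ⟨x', hx', rfl⟩ := hz
    rw [hS, Finset.mem_filter] at hx'
    rw [hB, Fintype.mem_piFinset]
    intro μ
    have hμ := (abs_sub_le_cdist x x' μ).trans hx'.2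
    rw [abs_le] at hμ
    have e1 : (chart x μ : ℝ) = ((x μ).val : ℝ) := by simp [chart]
    have e2 : ((chartEmb x' : Fin P.d → ℤ) μ : ℝ) = ((x' μ).val : ℝ) := by simp [chartEmb, chart]
    rw [Finset.mem_Icc]
    constructor
    · have : (chart x μ : ℝ) - R ≤ ((chartEmb x' : Fin P.d → ℤ) μ : ℝ) := by rw [e1, e2]; linarith
      exact_mod_cast this
    · have : ((chartEmb x' : Fin P.d → ℤ) μ : ℝ) ≤ (chart x μ : ℝ) + R := by rw [e1, e2]; linarith
      exact_mod_cast this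
  have hI : ∀ μ : Fin P.d, (Finset.Icc (chart x μ - R) (chart x μ + R)).card = 2 * R + 1 := fun μ => by
    rw [Int.card_Icc]; omega
  calc S.card = (S.map chartEmb).card := (Finset.card_map _).symm
    _ ≤ B.card := Finset.card_le_card hmap
    _ = ∏ μ : Fin P.d, (Finset.Icc (chart x μ - R) (chart x μ + R)).card := Fintype.card_piFinset _
    _ = ∏ _μ : Fin P.d, (2 * R + 1) := Finset.prod_congr rfl fun μ _ => hI μ
    _ = (2 * R + 1) ^ P.d := by rw [Finset.prod_const, Finset.card_univ, Fintype.card_fin]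

variable {Λ : Finset (Balaban1983to89.Site P j)} {κ c : ℝ} {U : GaugeField P j U1} {M : ℕ} {ρ : ℝ} {γ₀ c₀ δ₀ : ℝ}

/-- **THE SIZE OF THE (3.30) CORRECTION** under [6] (5.6) of the charted first-step operator: for `M ≥ 5`, `M > K_R`, `M > Θ₁`, `θ_W < 1`, `2ρM ≤ R`
and a bound `‖ψ(y_{x′})‖ ≤ S` (`S ≥ 0`) on the blocks of the sites of `Λ`,
`‖(C^{(0)}_{Λ,loc}(u₁)Q(u₁)*ψ)(x)‖ ≤ (2R+1)^d · 2K · L^{−d} · S`, `K = 2^dγ₀^{−1}(1−θ_W)^{−1}e^{δ₀/4}` — finitely many columns ((2.43)'s vanishing clause,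
the companion's `corr330_eq_sum_filter`), each bounded by the companion's `norm_cLocC_le_walk` times `‖(Q*ψ)(x′)‖ = L^{−d}‖ψ(y_{x′})‖`.
[cite: BalabanImbrieJaffe1988, (3.30) p.270] -/
theorem norm_corr330_le (hγ : 0 < γ₀) (hc₀ : 0 ≤ c₀) (hδ : 0 < δ₀) (hA : B4.Hyp56 (chartSet Λ) (reOp Λ (nOp κ c U 1 univ)) γ₀ c₀ δ₀)
    (hM : 5 ≤ M) (hMR : kR P.d 2 γ₀ c₀ δ₀ < M) (hMθ : thetaConst P.d 2 γ₀ c₀ δ₀ < M) (hθW : thetaW P.d 2 γ₀ c₀ δ₀ M < 1)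
    {R : ℕ} (hR : 2 * ρ * M ≤ R) {S : ℝ} (hS : 0 ≤ S) (ψ : Balaban1983to89.Site P (j + 1) → ℂ) (hψ : ∀ x' ∈ Λ, ‖ψ (blkIter 1 x')‖ ≤ S)
    (x : Balaban1983to89.Site P j) :
    ‖corr330 Λ κ c U M ρ ψ x‖ ≤
      (2 * R + 1) ^ P.d * (2 * (2 ^ P.d * γ₀⁻¹ * (1 - thetaW P.d 2 γ₀ c₀ δ₀ M)⁻¹ * Real.exp (δ₀ / 4))) * (((P.L : ℝ) ^ P.d)⁻¹ * S) := by
  set K := 2 * (2 ^ P.d * γ₀⁻¹ * (1 - thetaW P.d 2 γ₀ c₀ δ₀ M)⁻¹ * Real.exp (δ₀ / 4)) with hK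
  have hW : 0 < 1 - thetaW P.d 2 γ₀ c₀ δ₀ M := by linarith
  have hK0 : 0 ≤ K := by positivity
  have hMpos : (0 : ℝ) < M := by exact_mod_cast (show 0 < M by omega)
  -- each column contributes at most `K · L^{−d} · S`
  have hterm : ∀ x' : Balaban1983to89.Site P j,
      ‖cLocC Λ (nOp κ c U 1 univ) M ρ x x' * ((qMatT U 1)ᴴ *ᵥ ψ) x'‖ ≤ K * (((P.L : ℝ) ^ P.d)⁻¹ * S) := by
    intro x'
    by_cases hx' : x' ∈ Λ
    · rw [norm_mul, norm_qstar_mulVec]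
      have h1 : ‖cLocC Λ (nOp κ c U 1 univ) M ρ x x'‖ ≤ K := by
        refine (norm_cLocC_le_walk hγ hc₀ hδ hA hM hMR hMθ hθW x x').trans ?_
        have hexp : Real.exp (-(δ₀ / 8) * (cdist x x' / M)) ≤ 1 :=
          Real.exp_le_one_iff.2 (by nlinarith [div_nonneg (cdist_nonneg x x') hMpos.le])
        calc 2 * (2 ^ P.d * γ₀⁻¹ * (1 - thetaW P.d 2 γ₀ c₀ δ₀ M)⁻¹ * Real.exp (δ₀ / 4)) * Real.exp (-(δ₀ / 8) * (cdist x x' / M))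
            ≤ K * 1 := mul_le_mul_of_nonneg_left hexp hK0
          _ = K := mul_one _
      exact mul_le_mul h1 (mul_le_mul_of_nonneg_left (hψ x' hx') (by positivity)) (by positivity) hK0
    · rw [cLocC_of_not_mem_right x hx', zero_mul, norm_zero]
      positivity
  -- only the columns within chart distance `2ρM ≤ R` are present
  have hsub : (univ.filter fun x' : Balaban1983to89.Site P j => cdist x x' / M ≤ 2 * ρ) ⊆
      univ.filter fun x' : Balaban1983to89.Site P j => cdist x x' ≤ R := by
    intro x' hx'
    rw [Finset.mem_filter] at hx' ⊢
    refine ⟨mem_univ _, ?_⟩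
    have := (div_le_iff₀ hMpos).1 hx'.2
    linarith
  have hcard : ((univ.filter fun x' : Balaban1983to89.Site P j => cdist x x' / M ≤ 2 * ρ).card : ℝ) ≤ (2 * R + 1) ^ P.d := by
    have h := (Finset.card_le_card hsub).trans (card_filter_cdist_le x R)
    exact_mod_cast h
  rw [corr330_eq_sum_filter]
  calc ‖∑ x' ∈ univ.filter (fun x' => cdist x x' / M ≤ 2 * ρ), cLocC Λ (nOp κ c U 1 univ) M ρ x x' * ((qMatT U 1)ᴴ *ᵥ ψ) x'‖
      ≤ ∑ x' ∈ univ.filter (fun x' => cdist x x' / M ≤ 2 * ρ), ‖cLocC Λ (nOp κ c U 1 univ) M ρ x x' * ((qMatT U 1)ᴴ *ᵥ ψ) x'‖ :=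
        norm_sum_le _ _
    _ ≤ ∑ x' ∈ univ.filter (fun x' => cdist x x' / M ≤ 2 * ρ), K * (((P.L : ℝ) ^ P.d)⁻¹ * S) := Finset.sum_le_sum fun x' _ => hterm x'
    _ = (univ.filter fun x' : Balaban1983to89.Site P j => cdist x x' / M ≤ 2 * ρ).card * (K * (((P.L : ℝ) ^ P.d)⁻¹ * S)) := by
        rw [Finset.sum_const, nsmul_eq_mul]
    _ ≤ (2 * R + 1) ^ P.d * (K * (((P.L : ℝ) ^ P.d)⁻¹ * S)) := mul_le_mul_of_nonneg_right hcard (by positivity)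
    _ = _ := by rw [hK]; ring

/-- **THE CRUDE BOUND FOR THE NEW VARIABLE OF (3.30)**: with `φ^{(0)} := φ − aL^{−2}Λ₇C^{(0)}_{Λ,loc}(u₁)Q*(u₁)ψ` (the companion's `phi0_eq_sub`), under the
hypotheses of `norm_corr330_le` and `aL^{−2} ≥ 0`, `‖φ^{(0)}(x)‖ ≤ ‖φ(x)‖ + aL^{−2}·(2R+1)^d·2K·L^{−d}·S` at EVERY site.  (Print's λ-free *"|φ^{(0)}| ≦ cp(e₀)"*
of (3.33) is NOT this — see the module's HONEST SCOPE.) [cite: BalabanImbrieJaffe1988, (3.33) p.270] -/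
theorem norm_phi0_le (hγ : 0 < γ₀) (hc₀ : 0 ≤ c₀) (hδ : 0 < δ₀) {a L : ℝ} (ha : 0 ≤ a * L ^ (-(2 : ℤ)))
    (hA : B4.Hyp56 (chartSet Λ) (reOp Λ (nOp (a * L ^ (-(2 : ℤ))) c U 1 univ)) γ₀ c₀ δ₀)
    (hM : 5 ≤ M) (hMR : kR P.d 2 γ₀ c₀ δ₀ < M) (hMθ : thetaConst P.d 2 γ₀ c₀ δ₀ < M) (hθW : thetaW P.d 2 γ₀ c₀ δ₀ M < 1)
    {R : ℕ} (hR : 2 * ρ * M ≤ R) {S : ℝ} (hS : 0 ≤ S) (ψ : Balaban1983to89.Site P (j + 1) → ℂ) (hψ : ∀ x' ∈ Λ, ‖ψ (blkIter 1 x')‖ ≤ S)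
    (Λ₇ : Finset (Balaban1983to89.Site P j)) (φ φ0 : Balaban1983to89.Site P j → ℂ)
    (h330 : phi330 Λ₇ a L φ0 (corr330 Λ (a * L ^ (-(2 : ℤ))) c U M ρ ψ) = φ) (x : Balaban1983to89.Site P j) :
    ‖φ0 x‖ ≤ ‖φ x‖ + a * L ^ (-(2 : ℤ)) *
      ((2 * R + 1) ^ P.d * (2 * (2 ^ P.d * γ₀⁻¹ * (1 - thetaW P.d 2 γ₀ c₀ δ₀ M)⁻¹ * Real.exp (δ₀ / 4))) * (((P.L : ℝ) ^ P.d)⁻¹ * S)) := by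
  have hcorr := norm_corr330_le hγ hc₀ hδ hA hM hMR hMθ hθW hR hS ψ hψ x
  have h0 := congrFun ((phi0_eq_sub a L Λ₇ φ φ0 _).1 h330) x
  rw [h0]
  refine (norm_sub_le _ _).trans (add_le_add le_rfl ?_)
  split_ifs with hx
  · rw [norm_mul, Complex.norm_real, Real.norm_of_nonneg ha]
    exact mul_le_mul_of_nonneg_left hcorr ha
  · rw [norm_zero]
    exact mul_nonneg ha ((norm_nonneg _).trans hcorr)

/-- **THE SMALL-FIELD MEMBER** (§2 + `norm_corr330_le`): for the first-step operator at a small field `u₁` on a no-wrap region `Λ`, with the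
constants of [6] (5.6) EXPLICIT — `γ₀ = c240(c²,κ)(1−σ)`, `c₀ = 4dc²e^{δ₀} + κL^{−2d}e^{δ₀(L−1)}` — and p13's walk-data conditions at these constants:
`‖(C^{(0)}_{Λ,loc}(u₁)Q(u₁)*ψ)(x)‖ ≤ (2R+1)^d·2K·L^{−d}·S`. [cite: BalabanImbrieJaffe1988, (3.30) p.270] -/
theorem norm_corr330_le_smallField (hj : j + 1 ≤ P.m + P.K) (U : GaugeField P j U1) {T δ σ : ℝ}
    (hInt : ∀ b : PBond P j, blkIter 1 b.src = blkIter 1 b.tgt → ‖toC (U b) - 1‖ ≤ T)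
    (hTree : ∀ x : Balaban1983to89.Site P j, ‖holCK U 1 x - 1‖ ≤ δ)
    (hσ : 2 * (((P.L : ℝ) - 1) * P.L) * P.d * T ^ 2 + 2 * δ ^ 2 ≤ σ) (hσ1 : σ < 1)
    (hΛ : ∀ b : PBond P j, b.src ∈ Λ → b.tgt ∈ Λ → cdist b.src b.tgt ≤ 1) (hcne : c ≠ 0) (hκ : 0 < κ) (hδ : 0 < δ₀)
    (hM : 5 ≤ M)
    (hMR : kR P.d 2 (c240 P (c ^ 2) κ * (1 - σ) - 0)
      (4 * P.d * c ^ 2 * Real.exp δ₀ + κ * (((P.L : ℝ) ^ P.d)⁻¹) ^ 2 * Real.exp (δ₀ * ((P.L : ℝ) - 1))) δ₀ < M)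
    (hMθ : thetaConst P.d 2 (c240 P (c ^ 2) κ * (1 - σ) - 0)
      (4 * P.d * c ^ 2 * Real.exp δ₀ + κ * (((P.L : ℝ) ^ P.d)⁻¹) ^ 2 * Real.exp (δ₀ * ((P.L : ℝ) - 1))) δ₀ < M)
    (hθW : thetaW P.d 2 (c240 P (c ^ 2) κ * (1 - σ) - 0)
      (4 * P.d * c ^ 2 * Real.exp δ₀ + κ * (((P.L : ℝ) ^ P.d)⁻¹) ^ 2 * Real.exp (δ₀ * ((P.L : ℝ) - 1))) δ₀ M < 1)
    {R : ℕ} (hR : 2 * ρ * M ≤ R) {S : ℝ} (hS : 0 ≤ S) (ψ : Balaban1983to89.Site P (j + 1) → ℂ) (hψ : ∀ x' ∈ Λ, ‖ψ (blkIter 1 x')‖ ≤ S)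
    (x : Balaban1983to89.Site P j) :
    ‖corr330 Λ κ c U M ρ ψ x‖ ≤
      (2 * R + 1) ^ P.d * (2 * (2 ^ P.d * (c240 P (c ^ 2) κ * (1 - σ) - 0)⁻¹ *
        (1 - thetaW P.d 2 (c240 P (c ^ 2) κ * (1 - σ) - 0)
          (4 * P.d * c ^ 2 * Real.exp δ₀ + κ * (((P.L : ℝ) ^ P.d)⁻¹) ^ 2 * Real.exp (δ₀ * ((P.L : ℝ) - 1))) δ₀ M)⁻¹ *
        Real.exp (δ₀ / 4))) * (((P.L : ℝ) ^ P.d)⁻¹ * S) := by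
  have hγ : 0 < c240 P (c ^ 2) κ * (1 - σ) - 0 := by
    rw [sub_zero]
    exact mul_pos (c240_pos P (by positivity) hκ) (by linarith)
  have hc0 : 0 ≤ 4 * P.d * c ^ 2 * Real.exp δ₀ + κ * (((P.L : ℝ) ^ P.d)⁻¹) ^ 2 * Real.exp (δ₀ * ((P.L : ℝ) - 1)) := by positivity
  exact norm_corr330_le hγ hc0 hδ (hyp56_nOp_univ_smallField hj U hInt hTree hσ hΛ c hκ.le hδ.le) hM hMR hMθ hθW hR hS ψ hψ x

end Size

/-! ## §4  The (3.33) scalar half AT THE COMPOSED OBJECTS — p27's `small333_scalar_phi330_full` BY NAME -/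

section Small333

open BIJ88Small333ScalarField (small333_scalar_phi330_full)
open B4Sect5Proof (latticeConst)

variable {Λ : Finset (Balaban1983to89.Site P j)}

/-- **(3.33), THE SCALAR HALF *"|φ^{(0)}| ≦ cp(e₀)"* AT THE COMPOSED CORRECTION OF (3.30)** — p27 g40's λ-free fluctuation-mechanism theorem
`BIJ88Small333ScalarField.small333_scalar_phi330_full` (stated over an abstract kernel `K` characterised as the (2.43) packaging and abstract data `corr`)
INSTANTIATED BY NAME at the companion's objects: `K := cLocC Λ (nOp (aL⁻²) c u₁ 1 univ) M ρ` (`hK0` = `cLocC_of_not_mem_right`, `hKl` = `cLocC_of_mem`),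
`corr := corr330 Λ (aL⁻²) c u₁ M ρ ψ` (`hcorr` by `rfl`), `φ = phi330 Λ₇ a L φ^{(0)} corr330` (r18's (3.30)).  All other hypotheses and the constant are
p27's, verbatim. [cite: BalabanImbrieJaffe1988, (3.33) p.270] -/
theorem small333_scalar_corr330 {a L c : ℝ} (haL : 0 ≤ a * L ^ (-(2 : ℤ))) (U : GaugeField P j U1)
    (hΛ : BIJ88NeumannNoZeroModesTorus.IsBlockUnion 1 Λ) {γ₀ c₀ δ₀ : ℝ} (hγ : 0 < γ₀) (hc₀ : 0 ≤ c₀) (hδ : 0 < δ₀)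
    (hA : B4.Hyp56 (chartSet Λ) (reOp Λ (nOp (a * L ^ (-(2 : ℤ))) c U 1 univ)) γ₀ c₀ δ₀)
    (hU : IsUnit (compress Λ (nOp (a * L ^ (-(2 : ℤ))) c U 1 univ))) {M : ℕ} (hM : 5 ≤ M) (hMR : kR P.d 2 γ₀ c₀ δ₀ < M)
    (hMθ : thetaConst P.d 2 γ₀ c₀ δ₀ < M) (hθW : thetaW P.d 2 γ₀ c₀ δ₀ M < 1) (ρ : ℝ)
    {φ φ0 : Balaban1983to89.Site P j → ℂ} {ψ : Balaban1983to89.Site P (j + 1) → ℂ} {Λ₇ : Finset (Balaban1983to89.Site P j)}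
    (h7 : Λ₇ ⊆ Λ) (hφ : φ = phi330 Λ₇ a L φ0 (corr330 Λ (a * L ^ (-(2 : ℤ))) c U M ρ ψ))
    {pD pQ Φ Ψ R p c₁ : ℝ} (hΦ0 : 0 ≤ Φ)
    (hD : ∀ b : PBond P j, (b.src ∈ Λ ∨ b.tgt ∈ Λ) → ‖covD c (cfg U) φ b‖ ≤ pD)
    (hQ : ∀ y : Balaban1983to89.Site P (j + 1), blockK 1 y ⊆ Λ → ‖ψ y - (qMatT U 1 *ᵥ φ) y‖ ≤ pQ)
    (hΦ : ∀ b : PBond P j, (b.src ∈ Λ → b.tgt ∉ Λ → ‖φ b.tgt‖ ≤ Φ) ∧ (b.tgt ∈ Λ → b.src ∉ Λ → ‖φ b.src‖ ≤ Φ))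
    (hΨ : ∀ y : Balaban1983to89.Site P (j + 1), blockK 1 y ⊆ Λ → ‖ψ y‖ ≤ Ψ)
    (hR : ∀ x ∈ Λ₇, ∀ x₂ ∈ Λ, (∃ μ : Fin P.d, x₂.shift μ ∉ Λ ∨ x₂.unshift μ ∉ Λ) → R ≤ B5Ineq137Torus.T P j x x₂)
    (hpD : pD ≤ c₁ * p) (hpQ : pQ ≤ c₁ * p) (hRΦ : Real.exp (-(δ₀ / 16 / M * R)) * Φ ≤ p)
    (hδΨ : 2 ^ P.d * γ₀⁻¹ * (1 - thetaW P.d 2 γ₀ c₀ δ₀ M)⁻¹ * Real.exp (-(δ₀ / 16 * (ρ - 3))) * Ψ ≤ p) :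
    ∀ x ∈ Λ₇, ‖φ0 x‖ ≤
      (2 * (2 ^ P.d * γ₀⁻¹ * (1 - thetaW P.d 2 γ₀ c₀ δ₀ M)⁻¹ * Real.exp (δ₀ / 4)) * latticeConst P.d (δ₀ / 8 / M)
            * (|c| * (2 * P.d) + a * L ^ (-(2 : ℤ)) * ((P.L : ℝ) ^ P.d)⁻¹) * c₁
        + 2 * (2 ^ P.d * γ₀⁻¹ * (1 - thetaW P.d 2 γ₀ c₀ δ₀ M)⁻¹ * Real.exp (δ₀ / 4)) * latticeConst P.d (δ₀ / 16 / M)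
            * (|c| * (2 * P.d) * |c|)
        + a * L ^ (-(2 : ℤ)) * 2 * latticeConst P.d (δ₀ / 16 / M) * ((P.L : ℝ) ^ P.d)⁻¹) * p :=
  small333_scalar_phi330_full haL U hΛ hγ hc₀ hδ hA hU hM hMR hMθ hθW ρ (cLocC Λ (nOp (a * L ^ (-(2 : ℤ))) c U 1 univ) M ρ)
    (fun x₁ _ _ hx₂ => cLocC_of_not_mem_right x₁ hx₂) (fun x₁ x₂ => cLocC_of_mem x₁.2 x₂.2) h7 hφ (fun _ _ => rfl)
    hΦ0 hD hQ hΦ hΨ hR hpD hpQ hRΦ hδΨ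

/-- **(3.33) SCALAR HALF AT THE COMPOSED OBJECTS, SMALL-FIELD FORM**: the same with [6] (5.6) and the invertibility of `(−Δ_{u₁} + aL^{−2}Q(u₁)*Q(u₁))|_Λ`
DISCHARGED by §2 (`hyp56_nOp_univ_smallField`, `isUnit_compress_nOp_univ_smallField`) — `γ₀`, `c₀` THE EXPLICIT CONSTANTS `c240(c²,aL⁻²)(1−σ)` and
`4dc²e^{δ₀} + aL^{−2}L^{−2d}e^{δ₀(L−1)}` (entered as defining equations), small field `(T, δ, σ)` with `σ < 1`, `c ≠ 0`, `aL^{−2} > 0`, no-wrap `Λ`.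
[cite: BalabanImbrieJaffe1988, (3.33) p.270] -/
theorem small333_scalar_corr330_smallField (hj : j + 1 ≤ P.m + P.K) {a L c : ℝ} (haL : 0 < a * L ^ (-(2 : ℤ))) (hcne : c ≠ 0)
    (U : GaugeField P j U1) {T δ σ : ℝ}
    (hInt : ∀ b : PBond P j, blkIter 1 b.src = blkIter 1 b.tgt → ‖toC (U b) - 1‖ ≤ T)
    (hTree : ∀ x : Balaban1983to89.Site P j, ‖holCK U 1 x - 1‖ ≤ δ)
    (hσ : 2 * (((P.L : ℝ) - 1) * P.L) * P.d * T ^ 2 + 2 * δ ^ 2 ≤ σ) (hσ1 : σ < 1)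
    (hΛ : BIJ88NeumannNoZeroModesTorus.IsBlockUnion 1 Λ) (hΛw : ∀ b : PBond P j, b.src ∈ Λ → b.tgt ∈ Λ → cdist b.src b.tgt ≤ 1)
    {γ₀ c₀ δ₀ : ℝ} (hδ : 0 < δ₀) (hγ₀ : γ₀ = c240 P (c ^ 2) (a * L ^ (-(2 : ℤ))) * (1 - σ) - 0)
    (hc₀ : c₀ = 4 * P.d * c ^ 2 * Real.exp δ₀ + a * L ^ (-(2 : ℤ)) * (((P.L : ℝ) ^ P.d)⁻¹) ^ 2 * Real.exp (δ₀ * ((P.L : ℝ) - 1)))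
    {M : ℕ} (hM : 5 ≤ M) (hMR : kR P.d 2 γ₀ c₀ δ₀ < M) (hMθ : thetaConst P.d 2 γ₀ c₀ δ₀ < M) (hθW : thetaW P.d 2 γ₀ c₀ δ₀ M < 1) (ρ : ℝ)
    {φ φ0 : Balaban1983to89.Site P j → ℂ} {ψ : Balaban1983to89.Site P (j + 1) → ℂ} {Λ₇ : Finset (Balaban1983to89.Site P j)}
    (h7 : Λ₇ ⊆ Λ) (hφ : φ = phi330 Λ₇ a L φ0 (corr330 Λ (a * L ^ (-(2 : ℤ))) c U M ρ ψ))
    {pD pQ Φ Ψ R p c₁ : ℝ} (hΦ0 : 0 ≤ Φ)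
    (hD : ∀ b : PBond P j, (b.src ∈ Λ ∨ b.tgt ∈ Λ) → ‖covD c (cfg U) φ b‖ ≤ pD)
    (hQ : ∀ y : Balaban1983to89.Site P (j + 1), blockK 1 y ⊆ Λ → ‖ψ y - (qMatT U 1 *ᵥ φ) y‖ ≤ pQ)
    (hΦ : ∀ b : PBond P j, (b.src ∈ Λ → b.tgt ∉ Λ → ‖φ b.tgt‖ ≤ Φ) ∧ (b.tgt ∈ Λ → b.src ∉ Λ → ‖φ b.src‖ ≤ Φ))
    (hΨ : ∀ y : Balaban1983to89.Site P (j + 1), blockK 1 y ⊆ Λ → ‖ψ y‖ ≤ Ψ)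
    (hR : ∀ x ∈ Λ₇, ∀ x₂ ∈ Λ, (∃ μ : Fin P.d, x₂.shift μ ∉ Λ ∨ x₂.unshift μ ∉ Λ) → R ≤ B5Ineq137Torus.T P j x x₂)
    (hpD : pD ≤ c₁ * p) (hpQ : pQ ≤ c₁ * p) (hRΦ : Real.exp (-(δ₀ / 16 / M * R)) * Φ ≤ p)
    (hδΨ : 2 ^ P.d * γ₀⁻¹ * (1 - thetaW P.d 2 γ₀ c₀ δ₀ M)⁻¹ * Real.exp (-(δ₀ / 16 * (ρ - 3))) * Ψ ≤ p) :
    ∀ x ∈ Λ₇, ‖φ0 x‖ ≤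
      (2 * (2 ^ P.d * γ₀⁻¹ * (1 - thetaW P.d 2 γ₀ c₀ δ₀ M)⁻¹ * Real.exp (δ₀ / 4)) * latticeConst P.d (δ₀ / 8 / M)
            * (|c| * (2 * P.d) + a * L ^ (-(2 : ℤ)) * ((P.L : ℝ) ^ P.d)⁻¹) * c₁
        + 2 * (2 ^ P.d * γ₀⁻¹ * (1 - thetaW P.d 2 γ₀ c₀ δ₀ M)⁻¹ * Real.exp (δ₀ / 4)) * latticeConst P.d (δ₀ / 16 / M)
            * (|c| * (2 * P.d) * |c|)
        + a * L ^ (-(2 : ℤ)) * 2 * latticeConst P.d (δ₀ / 16 / M) * ((P.L : ℝ) ^ P.d)⁻¹) * p := by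
  have hγ : 0 < γ₀ := by
    rw [hγ₀, sub_zero]
    exact mul_pos (c240_pos P (by positivity) haL) (by linarith)
  have hc0 : 0 ≤ c₀ := by rw [hc₀]; positivity
  have hA : B4.Hyp56 (chartSet Λ) (reOp Λ (nOp (a * L ^ (-(2 : ℤ))) c U 1 univ)) γ₀ c₀ δ₀ := by
    rw [hγ₀, hc₀]
    exact hyp56_nOp_univ_smallField hj U hInt hTree hσ hΛw c haL.le hδ.le
  have hU : IsUnit (compress Λ (nOp (a * L ^ (-(2 : ℤ))) c U 1 univ)) :=
    isUnit_compress_nOp_univ_smallField hj U hInt hTree hσ hσ1 Λ hcne haL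
  exact small333_scalar_corr330 haL.le U hΛ hγ hc0 hδ hA hU hM hMR hMθ hθW ρ h7 hφ hΦ0 hD hQ hΦ hΨ hR hpD hpQ hRΦ hδΨ

end Small333

end

end Literature.MathematicalPhysics.QuantumFieldTheory.BalabanImbrieJaffe1984to88.BIJ88ScalarTranslation330Size
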